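/-
# Lattice sampling of Suzuki's screw function under «the supremum of the real parts is attained»
— part A (§§1–2: the Tannery form of the Bohr-mean lemma)

(rh-split cell, seat rh-split-screw-bridge g12, 2026-08-27; kernel scratch for card
`cards/SPLIT-screw-bridge.md` §17.)  Nothing in this file is a claim about the truth of RH.
-/
import Summits.RiemannHypothesis.RiemannHypothesis.Theorems.Splittings.ScrewLatticeFozA
import Mathlib.Analysis.Normed.Group.Tannery
import HarnessLib

/-!
# Part A — the Bohr-mean lemma for absolutely convergent unimodular trigonometric series

This is the analytic engine of `ScrewLatticeSupB`: the finite Bohr-mean lemma of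
`ScrewLatticeFoz.false_of_trigSum_eventually_ge` (g11) is upgraded from a finite index set `T` to an
arbitrary index type with a summable majorant, by letting the window `[N, 2N)` recede to infinity and
exchanging the limit with the series by **Tannery's theorem** (dominated convergence for series,
Mathlib `tendsto_tsum_of_dominated_convergence`).

**Main lemma** (`false_of_tsum_trig_eventually_ge`).  Let `b : ι → ℝ` be summable, `g_i : ℕ → ℝ`
real sequences with `|g_i(k)| ≤ b_i`, `c_i, u_i ∈ ℂ` with `‖u_i‖ = 1`, `Re c_i ≤ 0`, `‖c_i‖ ≤ b_i`,
and `g_i(k) - Re(c_i u_i^k) → 0` as `k → ∞` for every `i` (no uniformity in `i`).  If `Re c_{i₀} < 0`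
for some `i₀`, then `S_k = Σ'_i g_i(k)` cannot satisfy `liminf_k S_k ≥ 0`.

Proof.  For `‖v‖ = 1` the twisted window mean `A_v(N) = (1/N) Σ_{k∈[N,2N)} S_k v^k` equals
`Σ'_i a_i(N)` with `a_i(N) = (1/N) Σ_k g_i(k) v^k`, `‖a_i(N)‖ ≤ b_i`, and termwise
`a_i(N) → ([u_i v = 1] c_i + [ū_i v = 1] c̄_i)/2` (`tendsto_window_mean_term`); Tannery gives
`A_v(N) → Λ_v = Σ'_i (…)/2` (`tendsto_window_mean_tsum`).  Every `Re` of a summand of `Λ_v` is `≤ 0`,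
and for `v = ū_{i₀}` the `i₀` summand has real part `≤ Re c_{i₀}/2 < 0`; so `Re Λ_{ū_{i₀}} < 0` and
`Re Λ_1 ≤ 0`.  But `S_k ≥ -ε` on the window gives `-Re A_v(N) ≤ ‖A_v(N)‖ ≤ mean|S| ≤ Re A_1(N) + 2ε`
(`neg_re_window_le`), and letting `N → ∞`, `-Re Λ_{ū_{i₀}} ≤ Re Λ_1 + 2ε ≤ 2ε` for every `ε > 0`,
a contradiction.
-/

set_option linter.dupNamespace false

noncomputable section

open Complex Filter Topology Finset
open scoped ComplexConjugate

namespace Summit.RiemannHypothesis.RiemannHypothesis.Theorems.Splittings.ScrewLatticeSup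

open Summit.RiemannHypothesis.RiemannHypothesis.Theorems.Splittings.ScrewLatticeFoz

/-! ## 1. Receding window means -/

/-- The window mean `(1/N) Σ_{k∈[N,2N)} z^k` of a unimodular geometric sequence tends to `[z = 1]`. -/
theorem tendsto_window_geom_mean {z : ℂ} (hz : ‖z‖ = 1) :
    Tendsto (fun N : ℕ ↦ (∑ k ∈ Finset.Ico N (2 * N), z ^ k) / (N : ℂ)) atTop
      (𝓝 (if z = 1 then 1 else 0)) := by
  by_cases h1 : z = 1
  · subst h1
    rw [if_pos rfl]
    refine tendsto_const_nhds.congr' ?_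
    filter_upwards [eventually_ge_atTop 1] with N hN
    have hN' : (N : ℂ) ≠ 0 := by exact_mod_cast (by omega : N ≠ 0)
    rw [window_geom_sum_one, div_self hN']
  · rw [if_neg h1]
    refine squeeze_zero_norm (a := fun N : ℕ ↦ (2 / ‖1 - z‖) / (N : ℝ)) (fun N ↦ ?_)
      (tendsto_const_div_atTop_nhds_zero_nat _)
    rw [norm_div, Complex.norm_natCast]
    exact div_le_div_of_nonneg_right (norm_window_geom_sum_le hz h1 N) (Nat.cast_nonneg N)

/-- The window mean of `e_k w_k` tends to `0` when `e_k → 0` and `‖w_k‖ ≤ 1`. -/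
theorem tendsto_window_mean_null {e w : ℕ → ℂ} (he : Tendsto e atTop (𝓝 0))
    (hw : ∀ k, ‖w k‖ ≤ 1) :
    Tendsto (fun N : ℕ ↦ (∑ k ∈ Finset.Ico N (2 * N), e k * w k) / (N : ℂ)) atTop (𝓝 0) := by
  rw [Metric.tendsto_atTop] at he ⊢
  intro ε hε
  obtain ⟨N₀, hN₀⟩ := he (ε / 2) (half_pos hε)
  refine ⟨N₀, fun N hN ↦ ?_⟩
  rw [dist_zero_right]
  have hsum : ‖∑ k ∈ Finset.Ico N (2 * N), e k * w k‖ ≤ N * (ε / 2) := by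
    calc ‖∑ k ∈ Finset.Ico N (2 * N), e k * w k‖
        ≤ ∑ k ∈ Finset.Ico N (2 * N), ‖e k * w k‖ := norm_sum_le _ _
      _ ≤ ∑ k ∈ Finset.Ico N (2 * N), ε / 2 := by
          refine Finset.sum_le_sum fun k hk ↦ ?_
          have hk' : N₀ ≤ k := hN.trans (Finset.mem_Ico.1 hk).1
          have h1 := hN₀ k hk'
          rw [dist_zero_right] at h1
          rw [norm_mul]
          calc ‖e k‖ * ‖w k‖ ≤ ε / 2 * 1 :=
                mul_le_mul h1.le (hw k) (norm_nonneg _) (by positivity)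
            _ = ε / 2 := mul_one _
      _ = N * (ε / 2) := by
          rw [Finset.sum_const, Nat.card_Ico, nsmul_eq_mul, show 2 * N - N = N by omega]
  rcases Nat.eq_zero_or_pos N with hN0 | hNpos
  · subst hN0
    simpa using hε
  · have hNr : (0 : ℝ) < N := by exact_mod_cast hNpos
    rw [norm_div, Complex.norm_natCast, div_lt_iff₀ hNr]
    calc ‖∑ k ∈ Finset.Ico N (2 * N), e k * w k‖ ≤ N * (ε / 2) := hsum
      _ < ε * N := by nlinarith

/-- **Window mean of one term.**  For `‖u‖ = 1 = ‖v‖` and a real sequence `g_k` with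
`g_k - Re(c u^k) → 0`, `(1/N) Σ_{k∈[N,2N)} g_k v^k → ([u v = 1] c + [ū v = 1] c̄)/2`. -/
theorem tendsto_window_mean_term {c u v : ℂ} (hu : ‖u‖ = 1) (hv : ‖v‖ = 1) {g : ℕ → ℝ}
    (hg : Tendsto (fun k : ℕ ↦ g k - (c * u ^ k).re) atTop (𝓝 0)) :
    Tendsto (fun N : ℕ ↦ (∑ k ∈ Finset.Ico N (2 * N), (g k : ℂ) * v ^ k) / (N : ℂ)) atTop
      (𝓝 (((if u * v = 1 then c else 0) + (if conj u * v = 1 then conj c else 0)) / 2)) := by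
  have hp : ‖u * v‖ = 1 := by rw [norm_mul, hu, hv, mul_one]
  have hq : ‖conj u * v‖ = 1 := by rw [norm_mul, Complex.norm_conj, hu, hv, mul_one]
  -- decomposition of the `N`-th window mean
  have hdec : ∀ N : ℕ, (∑ k ∈ Finset.Ico N (2 * N), (g k : ℂ) * v ^ k) / (N : ℂ) =
      (c * ((∑ k ∈ Finset.Ico N (2 * N), (u * v) ^ k) / N) +
        conj c * ((∑ k ∈ Finset.Ico N (2 * N), (conj u * v) ^ k) / N)) / 2 +
      (∑ k ∈ Finset.Ico N (2 * N), (((g k - (c * u ^ k).re : ℝ) : ℂ) * v ^ k)) / N := by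
    intro N
    have hk : ∀ k : ℕ, (g k : ℂ) * v ^ k = (c * (u * v) ^ k + conj c * (conj u * v) ^ k) / 2 +
        ((g k - (c * u ^ k).re : ℝ) : ℂ) * v ^ k := by
      intro k
      have h := Complex.re_eq_add_conj (c * u ^ k)
      push_cast
      rw [h, map_mul, map_pow, mul_pow, mul_pow]
      ring
    rw [Finset.sum_congr rfl (fun k _ ↦ hk k), Finset.sum_add_distrib, add_div, ← Finset.sum_div,
      Finset.sum_add_distrib, ← Finset.mul_sum, ← Finset.mul_sum]
    ring
  rw [show (fun N : ℕ ↦ (∑ k ∈ Finset.Ico N (2 * N), (g k : ℂ) * v ^ k) / (N : ℂ)) =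
      fun N : ℕ ↦ (c * ((∑ k ∈ Finset.Ico N (2 * N), (u * v) ^ k) / N) +
        conj c * ((∑ k ∈ Finset.Ico N (2 * N), (conj u * v) ^ k) / N)) / 2 +
      (∑ k ∈ Finset.Ico N (2 * N), (((g k - (c * u ^ k).re : ℝ) : ℂ) * v ^ k)) / N from
    funext hdec]
  have h1 := (tendsto_window_geom_mean hp).const_mul c
  have h2 := (tendsto_window_geom_mean hq).const_mul (conj c)
  have h3 : Tendsto (fun N : ℕ ↦ (∑ k ∈ Finset.Ico N (2 * N),
      (((g k - (c * u ^ k).re : ℝ) : ℂ) * v ^ k)) / (N : ℂ)) atTop (𝓝 0) := by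
    refine tendsto_window_mean_null ?_ (fun k ↦ by rw [norm_pow, hv, one_pow])
    have h0 : Tendsto (fun x : ℝ ↦ (x : ℂ)) (𝓝 0) (𝓝 0) := by
      simpa using Complex.continuous_ofReal.tendsto 0
    exact h0.comp hg
  have hlim : c * (if u * v = 1 then (1 : ℂ) else 0) + conj c * (if conj u * v = 1 then (1 : ℂ) else 0) =
      (if u * v = 1 then c else 0) + (if conj u * v = 1 then conj c else 0) := by
    split_ifs <;> simp
  have := ((h1.add h2).div_const 2).add h3
  rw [hlim, add_zero] at this
  exact this

/-- **Window inequality.**  If `S_k ≥ -ε` (`ε ≥ 0`) for `k ∈ [N, 2N)`, `N ≥ 1` and `‖v‖ = 1`, then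
`-Re A_v(N) ≤ Re A_1(N) + 2ε`, where `A_w(N) = (1/N) Σ_{k∈[N,2N)} S_k w^k`
(`-Re A_v ≤ ‖A_v‖ ≤ mean |S| ≤ mean S + 2ε`). -/
theorem neg_re_window_le (S : ℕ → ℝ) {v : ℂ} (hv : ‖v‖ = 1) {N : ℕ} (hN : 1 ≤ N) {ε : ℝ}
    (hε : 0 ≤ ε) (hSε : ∀ k ∈ Finset.Ico N (2 * N), -ε ≤ S k) :
    -((∑ k ∈ Finset.Ico N (2 * N), ((S k : ℝ) : ℂ) * v ^ k) / (N : ℂ)).re ≤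
      ((∑ k ∈ Finset.Ico N (2 * N), ((S k : ℝ) : ℂ) * (1 : ℂ) ^ k) / (N : ℂ)).re + 2 * ε := by
  have hNpos : (0 : ℝ) < N := by exact_mod_cast hN
  set A : ℂ := (∑ k ∈ Finset.Ico N (2 * N), ((S k : ℝ) : ℂ) * v ^ k) / (N : ℂ) with hA
  -- (1) `‖A‖ ≤ mean |S|`
  have h1 : ‖A‖ ≤ (∑ k ∈ Finset.Ico N (2 * N), |S k|) / N := by
    rw [hA, norm_div, Complex.norm_natCast]
    gcongr
    refine (norm_sum_le _ _).trans (le_of_eq (Finset.sum_congr rfl fun k _ ↦ ?_))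
    rw [norm_mul, norm_pow, hv, one_pow, mul_one, Complex.norm_real, Real.norm_eq_abs]
  -- (2) `Re A_1 = mean S`
  have h2 : ((∑ k ∈ Finset.Ico N (2 * N), ((S k : ℝ) : ℂ) * (1 : ℂ) ^ k) / (N : ℂ)).re =
      (∑ k ∈ Finset.Ico N (2 * N), S k) / N := by
    rw [Complex.div_natCast_re, Complex.re_sum]
    congr 1
    exact Finset.sum_congr rfl fun k _ ↦ by simp
  -- (3) `Σ |S k| ≤ Σ S k + 2 ε N` on the window
  have h3 : ∑ k ∈ Finset.Ico N (2 * N), |S k| ≤ ∑ k ∈ Finset.Ico N (2 * N), S k + 2 * ε * N := by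
    have h : ∑ k ∈ Finset.Ico N (2 * N), |S k| ≤ ∑ k ∈ Finset.Ico N (2 * N), (S k + 2 * ε) := by
      refine Finset.sum_le_sum fun k hk ↦ ?_
      have hSk := hSε k hk
      rcases le_or_gt 0 (S k) with h | h
      · rw [abs_of_nonneg h]; linarith
      · rw [abs_of_neg h]; linarith
    rw [Finset.sum_add_distrib, Finset.sum_const, Nat.card_Ico, nsmul_eq_mul] at h
    have hc' : ((2 * N - N : ℕ) : ℝ) = N := by rw [show 2 * N - N = N by omega]
    rw [hc'] at h
    linarith
  -- (4) combine
  have h4 : -A.re ≤ ‖A‖ := (neg_le_abs _).trans (Complex.abs_re_le_norm A)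
  have h5 : (∑ k ∈ Finset.Ico N (2 * N), |S k|) / N ≤
      (∑ k ∈ Finset.Ico N (2 * N), S k) / N + 2 * ε := by
    calc (∑ k ∈ Finset.Ico N (2 * N), |S k|) / N
        ≤ (∑ k ∈ Finset.Ico N (2 * N), S k + 2 * ε * N) / N :=
          div_le_div_of_nonneg_right h3 hNpos.le
      _ = (∑ k ∈ Finset.Ico N (2 * N), S k) / N + 2 * ε := by
          field_simp
  rw [h2]
  linarith

/-! ## 2. The Tannery step and the Bohr-mean lemma for series -/

/-- **Tannery step.**  Under a summable majorant `b` (`|g_i(k)| ≤ b_i`), with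
`‖u_i‖ = 1 = ‖v‖` and `g_i(k) - Re(c_i u_i^k) → 0` for each `i`, the twisted window means of the
series `S_k = Σ'_i g_i(k)` converge:
`(1/N) Σ_{k∈[N,2N)} S_k v^k → Σ'_i ([u_i v = 1] c_i + [ū_i v = 1] c̄_i)/2`. -/
theorem tendsto_window_mean_tsum {ι : Type*} {b : ι → ℝ} (hb : Summable b) {g : ι → ℕ → ℝ}
    (hg : ∀ i k, |g i k| ≤ b i) {c u : ι → ℂ} (hu : ∀ i, ‖u i‖ = 1)
    (hlim : ∀ i, Tendsto (fun k : ℕ ↦ g i k - (c i * u i ^ k).re) atTop (𝓝 0))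
    {v : ℂ} (hv : ‖v‖ = 1) :
    Tendsto (fun N : ℕ ↦
        (∑ k ∈ Finset.Ico N (2 * N), ((∑' i, g i k : ℝ) : ℂ) * v ^ k) / (N : ℂ)) atTop
      (𝓝 (∑' i, ((if u i * v = 1 then c i else 0) +
        (if conj (u i) * v = 1 then conj (c i) else 0)) / 2)) := by
  -- summability of each `g · k`
  have hgs : ∀ k : ℕ, Summable fun i ↦ g i k := fun k ↦
    hb.of_norm_bounded fun i ↦ by rw [Real.norm_eq_abs]; exact hg i k
  -- the `N`-th window mean is the sum of the termwise window means
  have hA : ∀ N : ℕ, HasSum (fun i ↦ (∑ k ∈ Finset.Ico N (2 * N), (g i k : ℂ) * v ^ k) / (N : ℂ))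
      ((∑ k ∈ Finset.Ico N (2 * N), ((∑' i, g i k : ℝ) : ℂ) * v ^ k) / (N : ℂ)) := by
    intro N
    refine (hasSum_sum (f := fun k i ↦ (g i k : ℂ) * v ^ k) fun k _ ↦ ?_).div_const _
    exact (Complex.hasSum_ofReal.2 (hgs k).hasSum).mul_right _
  rw [show (fun N : ℕ ↦
      (∑ k ∈ Finset.Ico N (2 * N), ((∑' i, g i k : ℝ) : ℂ) * v ^ k) / (N : ℂ)) =
      fun N : ℕ ↦ ∑' i, (∑ k ∈ Finset.Ico N (2 * N), (g i k : ℂ) * v ^ k) / (N : ℂ) from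
    funext fun N ↦ (hA N).tsum_eq.symm]
  refine tendsto_tsum_of_dominated_convergence hb
    (fun i ↦ tendsto_window_mean_term (hu i) hv (hlim i)) (Filter.Eventually.of_forall fun N i ↦ ?_)
  -- the majorant: `‖a_i(N)‖ ≤ b_i`
  rcases Nat.eq_zero_or_pos N with hN0 | hNpos
  · subst hN0
    have hb0 : 0 ≤ b i := (abs_nonneg _).trans (hg i 0)
    simpa using hb0
  · have hNr : (0 : ℝ) < N := by exact_mod_cast hNpos
    rw [norm_div, Complex.norm_natCast, div_le_iff₀ hNr]
    calc ‖∑ k ∈ Finset.Ico N (2 * N), (g i k : ℂ) * v ^ k‖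
        ≤ ∑ k ∈ Finset.Ico N (2 * N), ‖(g i k : ℂ) * v ^ k‖ := norm_sum_le _ _
      _ ≤ ∑ k ∈ Finset.Ico N (2 * N), b i := Finset.sum_le_sum fun k _ ↦ by
          rw [norm_mul, norm_pow, hv, one_pow, mul_one, Complex.norm_real, Real.norm_eq_abs]
          exact hg i k
      _ = b i * N := by
          rw [Finset.sum_const, Nat.card_Ico, show 2 * N - N = N by omega, nsmul_eq_mul, mul_comm]

/-- **Bohr-mean lemma for series (Tannery form).**  Let `b` be summable, `|g_i(k)| ≤ b_i`,
`‖u_i‖ = 1`, `Re c_i ≤ 0`, `‖c_i‖ ≤ b_i`, and `g_i(k) - Re(c_i u_i^k) → 0` for every `i`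
(each at its own rate).  If `Re c_{i₀} < 0` for some `i₀`, then `S_k = Σ'_i g_i(k)` does **not**
satisfy `liminf S_k ≥ 0`: the hypothesis `∀ ε > 0, S_k ≥ -ε eventually` is contradictory.
The finite case (`ι` a `Finset`, `g_i(k) = Re(c_i u_i^k)`) is g11's
`ScrewLatticeFoz.false_of_trigSum_eventually_ge`; the point of the series form is that **no uniform
rate and no spectral gap** is needed — only termwise convergence under a summable majorant. -/
theorem false_of_tsum_trig_eventually_ge {ι : Type*} {b : ι → ℝ} (hb : Summable b)
    {g : ι → ℕ → ℝ} (hg : ∀ i k, |g i k| ≤ b i) {c u : ι → ℂ} (hu : ∀ i, ‖u i‖ = 1)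
    (hc : ∀ i, (c i).re ≤ 0) (hcb : ∀ i, ‖c i‖ ≤ b i)
    (hlim : ∀ i, Tendsto (fun k : ℕ ↦ g i k - (c i * u i ^ k).re) atTop (𝓝 0))
    {i₀ : ι} (h0 : (c i₀).re < 0)
    (hS : ∀ ε : ℝ, 0 < ε → ∃ N₁ : ℕ, ∀ k : ℕ, N₁ ≤ k → -ε ≤ ∑' i, g i k) : False := by
  classical
  have hu₀ : ‖u i₀‖ = 1 := hu i₀
  have hv₁ : ‖conj (u i₀)‖ = 1 := by rw [Complex.norm_conj, hu₀]
  -- the limits of the twisted (`v = ū_{i₀}`) and plain (`v = 1`) window means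
  have hT₁ := tendsto_window_mean_tsum hb hg hu hlim hv₁
  have hT₀ := tendsto_window_mean_tsum hb hg hu hlim (v := 1) norm_one
  -- the summands of the limits: norm `≤ b_i`, real part `≤ 0`
  have hLnorm : ∀ (v : ℂ) (i : ι), ‖((if u i * v = 1 then c i else 0) +
      (if conj (u i) * v = 1 then conj (c i) else 0)) / 2‖ ≤ b i := by
    intro v i
    rw [norm_div, RCLike.norm_two]
    have h1 : ‖(if u i * v = 1 then c i else 0 : ℂ)‖ ≤ ‖c i‖ := by split_ifs <;> simp
    have h2 : ‖(if conj (u i) * v = 1 then conj (c i) else 0 : ℂ)‖ ≤ ‖c i‖ := by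
      split_ifs <;> simp
    have h3 := norm_add_le (if u i * v = 1 then c i else 0 : ℂ)
      (if conj (u i) * v = 1 then conj (c i) else 0 : ℂ)
    linarith [hcb i]
  have hLre : ∀ (v : ℂ) (i : ι), (((if u i * v = 1 then c i else 0) +
      (if conj (u i) * v = 1 then conj (c i) else 0)) / 2 : ℂ).re ≤ 0 := by
    intro v i
    rw [re_div_two, Complex.add_re]
    have h1 : (if u i * v = 1 then c i else 0 : ℂ).re ≤ 0 := by
      split_ifs <;> simp [hc i]
    have h2 : (if conj (u i) * v = 1 then conj (c i) else 0 : ℂ).re ≤ 0 := by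
      split_ifs <;> simp [Complex.conj_re, hc i]
    linarith
  have hLs : ∀ v : ℂ, Summable fun i ↦ (((if u i * v = 1 then c i else 0) +
      (if conj (u i) * v = 1 then conj (c i) else 0)) / 2 : ℂ) :=
    fun v ↦ hb.of_norm_bounded fun i ↦ hLnorm v i
  have hLres : ∀ v : ℂ, Summable fun i ↦ (((if u i * v = 1 then c i else 0) +
      (if conj (u i) * v = 1 then conj (c i) else 0)) / 2 : ℂ).re :=
    fun v ↦ (Complex.hasSum_re (hLs v).hasSum).summable
  -- `Re Λ₁ ≤ Re c_{i₀}/2 < 0`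
  have hp₀ : u i₀ * conj (u i₀) = 1 := by
    rw [Complex.mul_conj, Complex.normSq_eq_norm_sq, hu₀]
    norm_num
  have hL₁i₀ : (((if u i₀ * conj (u i₀) = 1 then c i₀ else 0) +
      (if conj (u i₀) * conj (u i₀) = 1 then conj (c i₀) else 0)) / 2 : ℂ).re ≤ (c i₀).re / 2 := by
    rw [re_div_two, Complex.add_re, if_pos hp₀]
    have h2 : (if conj (u i₀) * conj (u i₀) = 1 then conj (c i₀) else 0 : ℂ).re ≤ 0 := by
      split_ifs <;> simp [Complex.conj_re, hc i₀]
    linarith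
  have hℓ₁ : (∑' i, (((if u i * conj (u i₀) = 1 then c i else 0) +
      (if conj (u i) * conj (u i₀) = 1 then conj (c i) else 0)) / 2 : ℂ)).re ≤ (c i₀).re / 2 := by
    rw [Complex.re_tsum (hLs _)]
    have h := (hLres (conj (u i₀))).neg.le_tsum i₀ (fun j _ ↦ by
      simpa using hLre (conj (u i₀)) j)
    rw [tsum_neg] at h
    linarith
  -- `Re Λ₀ ≤ 0`
  have hℓ₀ : (∑' i, (((if u i * 1 = 1 then c i else 0) +
      (if conj (u i) * 1 = 1 then conj (c i) else 0)) / 2 : ℂ)).re ≤ 0 := by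
    rw [Complex.re_tsum (hLs _)]
    have h : 0 ≤ ∑' i, -(((if u i * 1 = 1 then c i else 0) +
        (if conj (u i) * 1 = 1 then conj (c i) else 0)) / 2 : ℂ).re :=
      tsum_nonneg fun i ↦ neg_nonneg.2 (hLre 1 i)
    rw [tsum_neg] at h
    linarith
  -- `ε` and the floor
  set ℓ₁ : ℝ := (∑' i, (((if u i * conj (u i₀) = 1 then c i else 0) +
      (if conj (u i) * conj (u i₀) = 1 then conj (c i) else 0)) / 2 : ℂ)).re with hℓ₁def
  have hℓ₁neg : ℓ₁ < 0 := by linarith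
  set ε : ℝ := -ℓ₁ / 4 with hε
  have hε0 : 0 < ε := by rw [hε]; linarith
  obtain ⟨N₁, hN₁⟩ := hS ε hε0
  -- the window inequality, eventually in `N`
  have hkey : ∀ᶠ N : ℕ in atTop,
      -((∑ k ∈ Finset.Ico N (2 * N), ((∑' i, g i k : ℝ) : ℂ) * conj (u i₀) ^ k) / (N : ℂ)).re -
        ((∑ k ∈ Finset.Ico N (2 * N), ((∑' i, g i k : ℝ) : ℂ) * (1 : ℂ) ^ k) / (N : ℂ)).re ≤
        2 * ε := by
    filter_upwards [eventually_ge_atTop (max N₁ 1)] with N hN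
    have hN1 : 1 ≤ N := le_trans (le_max_right _ _) hN
    have hNN₁ : N₁ ≤ N := le_trans (le_max_left _ _) hN
    have h := neg_re_window_le (fun k ↦ ∑' i, g i k) hv₁ hN1 hε0.le
      (fun k hk ↦ hN₁ k (hNN₁.trans (Finset.mem_Ico.1 hk).1))
    linarith
  -- pass to the limit `N → ∞`
  have hlimF := ((Complex.continuous_re.tendsto _).comp hT₁).neg.sub
    ((Complex.continuous_re.tendsto _).comp hT₀)
  have hle := le_of_tendsto hlimF hkey
  have h2ε : 2 * ε = -ℓ₁ / 2 := by rw [hε]; ring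
  rw [← hℓ₁def] at hle
  linarith [hℓ₀]

end Summit.RiemannHypothesis.RiemannHypothesis.Theorems.Splittings.ScrewLatticeSup
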